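import Mathlib
import Summits.QuantumFields.YangMills.Theorems.CoarseStiffnessTailCappedCoarseStiffnessLLargeFieldCountGlue
import Summits.QuantumFields.YangMills.Theses.HistoryWedge

/-!
# Route `CoarseStiffnessTail` — LINE 1 ON THE HISTORY WEDGE: the large-field count bound, demanded only on the wedge `K ≤ m·(K − j + 1)` and only
# eventually in the height, already gives `UnitScaleTilt.HistoryTailL` AND the organ's floor `HistoryWedge.WedgeTailL` by name (lead's certificate,
# seat `ym-line-cst-p1` g7; helper on crux stmt-QuantumFields-25301)

Context.  Ruling idea-crit-5 #105 (2026-08-28) records the HISTORY WEDGE as a standing free hypothesis of every per-height / per-plaquette lever aimed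
at `UnitScaleTilt.HistoryTailL` (stmt-QuantumFields-19936): the consumer reads the history event `histGood K ⌊K/m⌋` of runs `K, K+1` only, i.e.
heights `j ≤ K' − ⌊K/m⌋`, all with the WEDGE GUARD `K' ≤ m·(K' − j + 1)`, and `γ₁` may depend on `m` (`T3HistoryTailReduction.…OnWedge`,
`T3AveragedTailProfile.historyTailAt_of_perPlaquetteOnWedge`).  Route `HistoryWedge` types the organ's FLOOR currency there: `WedgeTailL`
(stmt-QuantumFields-27959), a per-plaquette GEOMETRIC rate `D·ρ^{K−j}`, `ρL³ < 1`, for `1 ≤ j ≤ K ≤ m(K−j+1)`.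

THIS FILE (definition-free; bookkeeping on top of this line's landed certificates p635820/p636229).  Hypothesis, written out (no `def`):

  LargeFieldCountW := `∀ L b₀ p₀ (0 < b₀, 2 < p₀) ∀ m ≥ 1 ∃ γ₁ ∈ (0,1] ∀ F γ (F.L = L, 0 < γ ≤ γ₁) ∃ c₀ > 0, C₀, A, i₀ ∀ K j,`
  `1 ≤ j ≤ K → K ≤ m(K−j+1) → i₀ ≤ K−j → ∫ exp(c₀·p(g_{K−j})²·N_j) dGibbs_K ≤ exp((C₀ + A·log β_{K−j})·#Plaq_j)`

— LargeFieldCount (p636229: exponential moment of the count `N_j` of θ-large level-`j` averaged plaquettes) demanded ONLY on the wedge AND only from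
height `i₀` on, `γ₁` AFTER `m`, `(c₀, C₀, A, i₀)` per `(F, γ, m)`.

* §1 **`perPlaquetteAt_of_countAt`** — p636229's chessboard/joint-Peierls step made POINTWISE: the count bound at ONE pair `(K, j)` gives the
  per-plaquette tail `≤ e^{9000L³|C₀|}·β_{K−j}^{9000L³A}·e^{−c₀p(g_{K−j})²}` at THAT pair (so any restriction of the count currency composes);
* §2 **`schema_le_geometric`** — the Gaussian schema is a floor rate: `C·β_i^A·e^{−c·p(g_i)²} ≤ D·(1/(2L³))^i`, `ρL³ = ½`
  (`T3AveragedTailProfile.perHeight_bound` divided by the plaquette count `72·L^{3m}·L^{3i}`);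
* §3 **`perPlaquetteOnWedge_of_countOnWedge`** — SHALLOW HEIGHTS ARE FREE: at fixed `(F, γ, m)` the count bound from height `i₀` on gives the
  Gaussian schema at EVERY wedge pair, the heights `i < i₀` absorbed into `C = e^{9000L³|C₀|} + Σ_{i<i₀} e^{c₀p(g_i)²}` (`Gibbs ≤ 1`, `β ≥ 1`)
  — on the wedge each height meets finitely many cut-offs `K ≤ m(i+1)`, so nothing is lost;
* §4 **`historyTailL_of_largeFieldCountW : LargeFieldCountW → UnitScaleTilt.HistoryTailL`** and
  **`wedgeTailL_of_largeFieldCountW : LargeFieldCountW → HistoryWedge.WedgeTailL`**, both BY NAME;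
* §5 **`largeFieldCountW_of_largeFieldCount`**, **`wedgeTailL_of_cappedCoarseStiffnessL`**, **`historyTailL_of_cappedCoarseStiffnessL_onWedge`** — kernel partial
  order `CappedCoarseStiffnessL (25301) ⇒ LogStiffness ⇒ LargeFieldCount ⇒ LargeFieldCountW ⇒ {HistoryTailL's body, WedgeTailL (27959)}`.

READING (for planners; no claim about Bałaban's estimates).  What a siege of this line's located content ([Balaban1985UV3] (71) p.273 /
[Balaban1989LargeFieldII] §0 (0.10)–(0.12) integrated against the Gibbs law) must deliver for rung R3 is exactly LargeFieldCountW: joint Peierls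
bounds for the level-`j` large-field sets at rate `c₀p(g_{K−j})²` with an `(O(1) + A·log β)` allowance per plaquette, at every FIXED `(F, γ, m)`
only asymptotically in the height `i = K − j → ∞` (couplings `γL^{−i} → 0`) and only at depths `j ≤ (m−1)(i+1)+1`.  The wedge does not make this
elementary (tree: bounded depth `HistoryTailBoundedHeight`, logarithmic envelope `…ElementaryEnvelope`; the wedge allows depth linear in the
height — only the corner `m = 1`, `j ≤ 1`, is bounded depth).

HONEST SCOPE.  Conditional certificates only; LargeFieldCountW, LargeFieldCount, LogStiffness, the crux 25301, `WedgeTailL` 27959 and `HistoryTailL`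
19936 stay OPEN; `YM3TorusSU2` (rung R3, a RECORD rung, not the Clay statement) is NOT proved; the Yang–Mills mass gap is NOT touched.

References: J. Fröhlich, R. Israel, E. Lieb, B. Simon, CMP **62** (1978) 1–34 [FrohlichIsraelLiebSimon1978] (Thm 4.1, chessboard); T. Bałaban,
CMP **102** (1985) 255–275 [Balaban1985UV3] ((7) p.257, (71) p.273); C. King, CMP **103** (1986) 323–349 [King1986] ((3.12)).
-/

noncomputable section

namespace Summit.QuantumFields.YangMills.Theorems.CoarseStiffnessTailWedgeFloor

open MeasureTheory ProbabilityTheory Finset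
open Literature.MathematicalPhysics.QuantumFieldTheory
open Literature.MathematicalPhysics.QuantumFieldTheory.Balaban1983to89
open Literature.MathematicalPhysics.QuantumFieldTheory.Balaban1983to89.T3ContinuumYM3Torus
open Literature.MathematicalPhysics.QuantumFieldTheory.Balaban1983to89.T3UnitScaleTilt
open Literature.MathematicalPhysics.QuantumFieldTheory.Balaban1983to89.T3UnitLawDensityEML
open Literature.MathematicalPhysics.QuantumFieldTheory.Balaban1983to89.T3AveragedTailProfile
  (perHeight_bound historyTailAt_of_perPlaquetteOnWedge)
open Summit.QuantumFields.YangMills.Theorems.HistoryTailChessboardT3 (chessboardRP_T3)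
open Summit.QuantumFields.YangMills.Theorems.CoarseStiffnessTailHistoryTailOfStiffness (card_plaq_le_of_chessboard)
open Summit.QuantumFields.YangMills.Theorems.CoarseStiffnessTailLargeFieldCount (jointPeierls_of_count)
open Summit.QuantumFields.YangMills.Theorems.CoarseStiffnessTailLargeFieldCountGlue (largeFieldCount_of_cappedCoarseStiffnessL)

/-! ## §1 The count bound at ONE pair `(K, j)` gives the per-plaquette tail at that pair -/

section Pointwise

variable (F : T3Family)

/-- `β_i = (γL^{−i})⁻¹ ≥ 1` for `0 < γ ≤ 1`. [cite: Balaban1985UV3, (1)-(3) p.256] -/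
private theorem one_le_beta {γ : ℝ} (hγ : 0 < γ) (hγ1 : γ ≤ 1) (i : ℕ) : 1 ≤ (F.scheme ℰp γ).β i := by
  have hL1' : (1 : ℝ) ≤ F.L := by exact_mod_cast F.hL.2.le
  have hL0' : (0 : ℝ) < F.L := lt_of_lt_of_le one_pos hL1'
  have hpos' : 0 < γ * ((F.L : ℝ)⁻¹) ^ i := mul_pos hγ (pow_pos (inv_pos.mpr hL0') _)
  have hle' : γ * ((F.L : ℝ)⁻¹) ^ i ≤ 1 :=
    (mul_le_of_le_one_right hγ.le (pow_le_one₀ (inv_nonneg.mpr hL0'.le) (inv_le_one_of_one_le₀ hL1'))).trans hγ1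
  show 1 ≤ (γ * ((F.L : ℝ)⁻¹) ^ i)⁻¹
  exact (one_le_inv₀ hpos').mpr hle'

/-- **THE PER-PLAQUETTE TAIL FROM THE COUNT BOUND, POINTWISE IN `(K, j)`** (one family `F`, one coupling `0 < γ ≤ 1`, `0 < c₀`, any
profile, ONE cut-off `K` and ONE height `j ≤ K`): if `∫ exp(c₀·p(g_{K−j})²·N_j) dGibbs_K ≤ exp((C₀ + A·log β_{K−j})·#Plaq_j)` at this pair,
then every level-`j` plaquette `p` has `Gibbs_K{θ(K−j) ≤ |Ū^j(∂p) − 1|} ≤ e^{9000L³|C₀|}·β_{K−j}^{9000L³A}·exp(−c₀·p(g_{K−j})²)` —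
chessboard (`chessboardRP_T3`, `ρ = 1`) to the joint event of the chessboard family `S ∋ p`, `jointPeierls_of_count` on `S`, and the
`1/|S|`-th root with `#Plaq_j ≤ 9000L³·|S|` — the proof of `…LargeFieldCountGlue.perPlaquette_of_largeFieldCount` (p636229), which used its
all-pairs hypothesis only at `(K, j)`. [cite: FrohlichIsraelLiebSimon1978, Thm 4.1] -/
theorem perPlaquetteAt_of_countAt {γ b₀ p₀ c₀ C₀ : ℝ} {A : ℕ} (hγ : 0 < γ) (hγ1 : γ ≤ 1) (hc₀ : 0 < c₀)
    {K j : ℕ} (hjK : j ≤ K)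
    (hN : ∫ U, Real.exp (c₀ * B10.pFun b₀ p₀ (Real.sqrt (γ * ((F.L : ℝ)⁻¹) ^ (K - j))) ^ 2 *
          ∑ a : Plaq (F.P K) j, (if θBal F.L γ b₀ p₀ (K - j) ≤ GaugeGroup.dist1 (GaugeField.plaqHol
            (Averaging.iter (fun i => BlockAveraging.blockAvg (P := F.P K) (j := i) ℰp) j U) a) then (1 : ℝ) else 0))
          ∂(gibbsK F ℰp γ K) ≤
        Real.exp ((C₀ + A * Real.log ((γ * ((F.L : ℝ)⁻¹) ^ (K - j))⁻¹)) * (Fintype.card (Plaq (F.P K) j) : ℝ)))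
    (p : Plaq (F.P K) j) :
    (gibbsK F ℰp γ K).real
        {U | θBal F.L γ b₀ p₀ (K - j) ≤
          GaugeGroup.dist1 (GaugeField.plaqHol
            (Averaging.iter (fun i => BlockAveraging.blockAvg (P := F.P K) (j := i) ℰp) j U) p)} ≤
      Real.exp (9000 * (F.L : ℝ) ^ 3 * |C₀|) * (F.scheme ℰp γ).β (K - j) ^ (9000 * F.L ^ 3 * A) *
        Real.exp (-(c₀ * B10.pFun b₀ p₀ (Real.sqrt (γ * ((F.L : ℝ)⁻¹) ^ (K - j))) ^ 2)) := by
  haveI := isProbabilityMeasure_gibbsK F ℰp hγ.le K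
  have hL1 : 1 < F.L := F.hL.2
  set θ : ℝ := θBal F.L γ b₀ p₀ (K - j) with hθdef
  set β : ℝ := (γ * ((F.L : ℝ)⁻¹) ^ (K - j))⁻¹ with hβdef
  have hβ1 : 1 ≤ β := one_le_beta F hγ hγ1 (K - j)
  have hβ0 : 0 < β := lt_of_lt_of_le one_pos hβ1
  have hlogβ : 0 ≤ Real.log β := Real.log_nonneg hβ1
  have hβeq : (F.scheme ℰp γ).β (K - j) = β := rfl
  set psq : ℝ := B10.pFun b₀ p₀ (Real.sqrt (γ * ((F.L : ℝ)⁻¹) ^ (K - j))) ^ 2 with hpsqdef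
  have hpsq0 : 0 ≤ psq := sq_nonneg _
  -- the logarithmic constant at this height, and its nonnegative majorant
  set C₁ : ℝ := C₀ + A * Real.log β with hC₁def
  set M : ℝ := |C₀| + A * Real.log β with hMdef
  have hM0 : 0 ≤ M := add_nonneg (abs_nonneg _) (mul_nonneg (Nat.cast_nonneg _) hlogβ)
  have hC₁M : C₁ ≤ M := by
    rw [hC₁def, hMdef]
    linarith [le_abs_self C₀]
  -- the chessboard family at separation `ρ = 1`
  obtain ⟨S, hpS, -, hcount, hchess⟩ :=
    chessboardRP_T3 F.L F.hL.1 hL1 F γ rfl hγ hγ1 θ K j hjK 1 le_rfl p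
  have hS0 : 0 < S.card := Finset.card_pos.mpr ⟨p, hpS⟩
  have hS0R : (0 : ℝ) < (S.card : ℝ) := by exact_mod_cast hS0
  -- joint Peierls for the family `S` at rate `t = c₀ p²`
  set t : ℝ := c₀ * psq with htdef
  have ht0 : 0 ≤ t := mul_nonneg hc₀.le hpsq0
  have hjoint : (gibbsK F ℰp γ K).real {U | ∀ q ∈ S, θ ≤ GaugeGroup.dist1 (GaugeField.plaqHol
        (Averaging.iter (fun _ => BlockAveraging.blockAvg ℰp) j U) q)} ≤
      Real.exp (-t * (S.card : ℝ)) * Real.exp (C₁ * (Fintype.card (Plaq (F.P K) j) : ℝ)) :=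
    jointPeierls_of_count F hγ.le K j θ ht0 hN S
  -- take the `1/|S|`-th power
  have hbase0 : 0 ≤ (gibbsK F ℰp γ K).real {U | ∀ q ∈ S, θ ≤ GaugeGroup.dist1 (GaugeField.plaqHol
        (Averaging.iter (fun _ => BlockAveraging.blockAvg ℰp) j U) q)} := measureReal_nonneg
  have hexpS : 0 ≤ (1 : ℝ) / (S.card : ℝ) := by positivity
  have hpow := Real.rpow_le_rpow hbase0 hjoint hexpS
  have hrhs : (Real.exp (-t * (S.card : ℝ)) * Real.exp (C₁ * (Fintype.card (Plaq (F.P K) j) : ℝ))) ^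
        ((1 : ℝ) / (S.card : ℝ)) =
      Real.exp (-t + C₁ * (Fintype.card (Plaq (F.P K) j) : ℝ) / (S.card : ℝ)) := by
    rw [← Real.exp_add, ← Real.exp_mul]
    congr 1
    field_simp
  rw [hrhs] at hpow
  refine (hchess.trans hpow).trans ?_
  -- the constants: `C₁ #Plaq_j / |S| ≤ 9000 L³ M`
  have hcard : (Fintype.card (Plaq (F.P K) j) : ℝ) ≤ 9000 * (F.L : ℝ) ^ 3 * (S.card : ℝ) :=
    card_plaq_le_of_chessboard F K j hcount
  have hC : C₁ * (Fintype.card (Plaq (F.P K) j) : ℝ) / (S.card : ℝ) ≤ 9000 * (F.L : ℝ) ^ 3 * M := by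
    rw [div_le_iff₀ hS0R]
    have h1 : C₁ * (Fintype.card (Plaq (F.P K) j) : ℝ) ≤ M * (Fintype.card (Plaq (F.P K) j) : ℝ) :=
      mul_le_mul_of_nonneg_right hC₁M (Nat.cast_nonneg _)
    have h2 : M * (Fintype.card (Plaq (F.P K) j) : ℝ) ≤ M * (9000 * (F.L : ℝ) ^ 3 * (S.card : ℝ)) :=
      mul_le_mul_of_nonneg_left hcard hM0
    nlinarith
  -- `exp(9000L³·M) = exp(9000L³|C₀|)·β^{9000L³A}`
  have hsplit : Real.exp (9000 * (F.L : ℝ) ^ 3 * M) =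
      Real.exp (9000 * (F.L : ℝ) ^ 3 * |C₀|) * β ^ (9000 * F.L ^ 3 * A) := by
    rw [hMdef, mul_add, Real.exp_add]
    congr 1
    rw [show 9000 * (F.L : ℝ) ^ 3 * (A * Real.log β) = ((9000 * F.L ^ 3 * A : ℕ) : ℝ) * Real.log β by push_cast; ring,
      ← Real.log_pow, Real.exp_log (pow_pos hβ0 _)]
  rw [hβeq, ← hsplit, mul_comm (Real.exp (9000 * (F.L : ℝ) ^ 3 * M)), ← Real.exp_add]
  exact Real.exp_le_exp.mpr (by linarith)

end Pointwise

/-! ## §2 The Gaussian schema is a floor rate: `C·β_i^A·e^{−c p(g_i)²} ≤ D·(1/(2L³))^i` -/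

section Geometric

variable (F : T3Family)

/-- **THE GAUSSIAN SCHEMA IS BELOW A GEOMETRIC RATE WITH `ρL³ = ½`** (`0 < γ ≤ 1`, `0 < b₀`, `1 ≤ p₀`, `C ≥ 0`, `c > 0`): there is
`D ≥ 0` (explicitly `A'/(72·L^{3m})` with the constant `A'` of `T3AveragedTailProfile.perHeight_bound`) with
`C·β_i^A·exp(−c·p(g_i)²) ≤ D·(1/(2L³))^i` for every height `i` — `perHeight_bound` states
`72·L^{3m}·L^{3i}·(C β_i^A e^{−cp(g_i)²}) ≤ A'·2^{−i}` («Gaussian beats exponential»: `p(g_i) ≥ ½b₀·i·log L`), divide by the count: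
every per-plaquette bound in the tree's Gaussian schema is a bound in route `HistoryWedge`'s floor currency `D·ρ^{K−j}`, `ρ = 1/(2L³)`.
[cite: Balaban1985UV3, (7) p.257 and (71) p.273] -/
theorem schema_le_geometric {γ b₀ p₀ : ℝ} (hγ : 0 < γ) (hγ1 : γ ≤ 1) (hb₀ : 0 < b₀) (hp₀ : 1 ≤ p₀)
    {C : ℝ} (hC : 0 ≤ C) (A : ℕ) {c : ℝ} (hc : 0 < c) :
    ∃ D : ℝ, 0 ≤ D ∧ ∀ i : ℕ,
      C * (F.scheme ℰp γ).β i ^ A * Real.exp (-(c * B10.pFun b₀ p₀ (Real.sqrt (γ * ((F.L : ℝ)⁻¹) ^ i)) ^ 2)) ≤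
        D * (1 / (2 * (F.L : ℝ) ^ 3)) ^ i := by
  have hL1 : (1 : ℝ) < F.L := by exact_mod_cast F.hL.2
  have hL0 : (0 : ℝ) < F.L := one_pos.trans hL1
  -- the explicit constant of `perHeight_bound`
  obtain ⟨A', hA'def⟩ : ∃ A' : ℝ, A' = 72 * C * (F.L : ℝ) ^ (3 * F.m) * γ⁻¹ ^ A *
      Real.exp ((((3 : ℝ) + A) * Real.log F.L + Real.log 2) ^ 2 / (4 * (c * b₀ ^ 2 * Real.log F.L ^ 2 / 4))) := ⟨_, rfl⟩
  have hA'0 : 0 ≤ A' := by rw [hA'def]; positivity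
  have hV0 : (0 : ℝ) < 72 * (F.L : ℝ) ^ (3 * F.m) := by positivity
  refine ⟨A' / (72 * (F.L : ℝ) ^ (3 * F.m)), div_nonneg hA'0 hV0.le, fun i => ?_⟩
  have hph := perHeight_bound F hγ hγ1 hb₀ hp₀ hC A hc i
  rw [← hA'def] at hph
  have hLi0 : (0 : ℝ) < ((F.L : ℝ) ^ i) ^ 3 := by positivity
  -- `(1/(2L³))^i = (1/2)^i / (L^i)^3`
  have hgeom : (1 / (2 * (F.L : ℝ) ^ 3)) ^ i = ((1 : ℝ) / 2) ^ i / ((F.L : ℝ) ^ i) ^ 3 := by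
    rw [div_pow, div_pow, one_pow, mul_pow, ← pow_mul, ← pow_mul, mul_comm 3 i, div_div]
  rw [hgeom, ← mul_div_assoc, le_div_iff₀ hLi0, div_mul_eq_mul_div, le_div_iff₀ hV0]
  calc C * (F.scheme ℰp γ).β i ^ A * Real.exp (-(c * B10.pFun b₀ p₀ (Real.sqrt (γ * ((F.L : ℝ)⁻¹) ^ i)) ^ 2)) *
        ((F.L : ℝ) ^ i) ^ 3 * (72 * (F.L : ℝ) ^ (3 * F.m))
      = (9 * (8 * (F.L : ℝ) ^ (3 * F.m) * ((F.L : ℝ) ^ i) ^ 3)) *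
          (C * (F.scheme ℰp γ).β i ^ A *
            Real.exp (-(c * B10.pFun b₀ p₀ (Real.sqrt (γ * ((F.L : ℝ)⁻¹) ^ i)) ^ 2))) := by ring
    _ ≤ A' * ((1 : ℝ) / 2) ^ i := hph

end Geometric

/-! ## §3 On the wedge, the count bound from height `i₀` on gives the per-plaquette schema at EVERY wedge pair -/

section Absorb

variable (F : T3Family)

/-- **SHALLOW HEIGHTS ARE FREE ON THE WEDGE** (one family `F`, one coupling `0 < γ ≤ 1`, one `m`, `0 < c₀`): if the count bound
`∫ exp(c₀·p(g_{K−j})²·N_j) dGibbs_K ≤ exp((C₀ + A·log β_{K−j})·#Plaq_j)` holds at the wedge pairs `1 ≤ j ≤ K ≤ m(K−j+1)` of height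
`K − j ≥ i₀` only, then the per-plaquette Gaussian schema holds at ALL wedge pairs `1 ≤ j ≤ K ≤ m(K−j+1)` with
`C = e^{9000L³|C₀|} + Σ_{i<i₀} e^{c₀p(g_i)²}`, exponent `9000L³A`, rate `c₀`: from height `i₀` on by §1, below it by
`Gibbs ≤ 1 = e^{c₀p(g_i)²}·e^{−c₀p(g_i)²} ≤ C·β^{9000L³A}·e^{−c₀p(g_i)²}` (`β ≥ 1`).  (The guard `K ≤ m(K−j+1)` is carried, not used: the
absorption works pair by pair.) [cite: Balaban1985UV3, (7) p.257 and (71) p.273] -/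
theorem perPlaquetteOnWedge_of_countOnWedge {γ b₀ p₀ c₀ C₀ : ℝ} {A i₀ m : ℕ} (hγ : 0 < γ) (hγ1 : γ ≤ 1) (hc₀ : 0 < c₀)
    (hN : ∀ (K j : ℕ), 1 ≤ j → j ≤ K → K ≤ m * (K - j + 1) → i₀ ≤ K - j →
      ∫ U, Real.exp (c₀ * B10.pFun b₀ p₀ (Real.sqrt (γ * ((F.L : ℝ)⁻¹) ^ (K - j))) ^ 2 *
          ∑ a : Plaq (F.P K) j, (if θBal F.L γ b₀ p₀ (K - j) ≤ GaugeGroup.dist1 (GaugeField.plaqHol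
            (Averaging.iter (fun i => BlockAveraging.blockAvg (P := F.P K) (j := i) ℰp) j U) a) then (1 : ℝ) else 0))
          ∂(gibbsK F ℰp γ K) ≤
        Real.exp ((C₀ + A * Real.log ((γ * ((F.L : ℝ)⁻¹) ^ (K - j))⁻¹)) * (Fintype.card (Plaq (F.P K) j) : ℝ))) :
    ∃ (C : ℝ) (A' : ℕ) (c : ℝ), 0 ≤ C ∧ 0 < c ∧
      ∀ (K j : ℕ), 1 ≤ j → j ≤ K → K ≤ m * (K - j + 1) → ∀ p : Plaq (F.P K) j,
        (gibbsK F ℰp γ K).real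
            {U | θBal F.L γ b₀ p₀ (K - j) ≤
              GaugeGroup.dist1 (GaugeField.plaqHol
                (Averaging.iter (fun i => BlockAveraging.blockAvg (P := F.P K) (j := i) ℰp) j U) p)} ≤
          C * (F.scheme ℰp γ).β (K - j) ^ A' *
            Real.exp (-(c * B10.pFun b₀ p₀ (Real.sqrt (γ * ((F.L : ℝ)⁻¹) ^ (K - j))) ^ 2)) := by
  -- the shallow-height reserve `Σ_{i<i₀} e^{c₀ p(g_i)²}`
  set R : ℝ := ∑ i ∈ Finset.range i₀, Real.exp (c₀ * B10.pFun b₀ p₀ (Real.sqrt (γ * ((F.L : ℝ)⁻¹) ^ i)) ^ 2) with hRdef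
  have hR0 : 0 ≤ R := Finset.sum_nonneg fun i _ => (Real.exp_pos _).le
  have hE0 : 0 ≤ Real.exp (9000 * (F.L : ℝ) ^ 3 * |C₀|) := (Real.exp_pos _).le
  refine ⟨Real.exp (9000 * (F.L : ℝ) ^ 3 * |C₀|) + R, 9000 * F.L ^ 3 * A, c₀, add_nonneg hE0 hR0, hc₀,
    fun K j hj1 hjK hw p => ?_⟩
  haveI := isProbabilityMeasure_gibbsK F ℰp hγ.le K
  have hβ1 : 1 ≤ (F.scheme ℰp γ).β (K - j) := one_le_beta F hγ hγ1 (K - j)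
  have hβA1 : 1 ≤ (F.scheme ℰp γ).β (K - j) ^ (9000 * F.L ^ 3 * A) := one_le_pow₀ hβ1
  have hβA0 : 0 ≤ (F.scheme ℰp γ).β (K - j) ^ (9000 * F.L ^ 3 * A) := zero_le_one.trans hβA1
  set e : ℝ := Real.exp (-(c₀ * B10.pFun b₀ p₀ (Real.sqrt (γ * ((F.L : ℝ)⁻¹) ^ (K - j))) ^ 2)) with hedef
  have he0 : 0 ≤ e := (Real.exp_pos _).le
  by_cases hi : i₀ ≤ K - j
  · -- from height `i₀` on: §1
    have h1 := perPlaquetteAt_of_countAt F hγ hγ1 hc₀ hjK (hN K j hj1 hjK hw hi) p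
    refine h1.trans ?_
    have : 0 ≤ R * (F.scheme ℰp γ).β (K - j) ^ (9000 * F.L ^ 3 * A) * e := by positivity
    nlinarith
  · -- below `i₀`: `Gibbs ≤ 1 = e^{c₀p²}·e^{−c₀p²} ≤ R·β^{A'}·e`
    rw [not_le] at hi
    have hone : (gibbsK F ℰp γ K).real
        {U | θBal F.L γ b₀ p₀ (K - j) ≤
          GaugeGroup.dist1 (GaugeField.plaqHol
            (Averaging.iter (fun i => BlockAveraging.blockAvg (P := F.P K) (j := i) ℰp) j U) p)} ≤ 1 :=
      measureReal_le_one
    have hterm : Real.exp (c₀ * B10.pFun b₀ p₀ (Real.sqrt (γ * ((F.L : ℝ)⁻¹) ^ (K - j))) ^ 2) ≤ R :=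
      Finset.single_le_sum (f := fun i => Real.exp (c₀ * B10.pFun b₀ p₀ (Real.sqrt (γ * ((F.L : ℝ)⁻¹) ^ i)) ^ 2))
        (fun i _ => (Real.exp_pos _).le) (Finset.mem_range.mpr hi)
    have hinv : Real.exp (c₀ * B10.pFun b₀ p₀ (Real.sqrt (γ * ((F.L : ℝ)⁻¹) ^ (K - j))) ^ 2) * e = 1 := by
      rw [hedef, ← Real.exp_add, add_neg_cancel, Real.exp_zero]
    refine hone.trans ?_
    calc (1 : ℝ) = Real.exp (c₀ * B10.pFun b₀ p₀ (Real.sqrt (γ * ((F.L : ℝ)⁻¹) ^ (K - j))) ^ 2) * 1 * e := by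
          rw [mul_one, hinv]
      _ ≤ R * (F.scheme ℰp γ).β (K - j) ^ (9000 * F.L ^ 3 * A) * e := by
          gcongr
      _ ≤ (Real.exp (9000 * (F.L : ℝ) ^ 3 * |C₀|) + R) * (F.scheme ℰp γ).β (K - j) ^ (9000 * F.L ^ 3 * A) * e := by
          have : 0 ≤ Real.exp (9000 * (F.L : ℝ) ^ 3 * |C₀|) * (F.scheme ℰp γ).β (K - j) ^ (9000 * F.L ^ 3 * A) * e := by
            positivity
          nlinarith

end Absorb

/-! ## §4 LargeFieldCount on the wedge, eventually in the height, gives `HistoryTailL` AND the floor `WedgeTailL` by name -/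

section Wedge

/-- **LARGE-FIELD COUNT ON THE HISTORY WEDGE ⇒ `UnitScaleTilt.HistoryTailL`** (crux stmt-QuantumFields-19936 of the parent route, BY NAME).
Hypothesis LargeFieldCountW (written out, no `def`): `∀ L b₀ p₀ (0 < b₀, 2 < p₀) ∀ m ≥ 1 ∃ γ₁ ∈ (0,1] ∀ F γ (F.L = L, 0 < γ ≤ γ₁)`
`∃ c₀ > 0, C₀, A, i₀ ∀ K j, 1 ≤ j ≤ K → K ≤ m·(K−j+1) → i₀ ≤ K−j → ∫ exp(c₀·p(g_{K−j})²·N_j) dGibbs_K ≤ exp((C₀ + A·log β_{K−j})·#Plaq_j)` —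
the count bound of p636229 demanded ONLY on the wedge and ONLY from height `i₀` on, `γ₁` after `m`, constants per `(F, γ, m)`.  Proof: profile
`(b₀, p₀) = (max b₁ 1, max p₁ 3)`; §3 gives the Gaussian schema at every wedge pair; `T3AveragedTailProfile.historyTailAt_of_perPlaquetteOnWedge`.
Conditional certificate; the hypothesis (Bałaban's large-field factors (71) summed over the large-field sets of the wedge levels, integrated
against the Gibbs law) is OPEN; no rung or summit is proved. [cite: Balaban1985UV3, (7) p.257 and (71) p.273; King1986, (3.12) p.657] -/
theorem historyTailL_of_largeFieldCountW
    (hW : ∀ (L : ℕ) (b₀ p₀ : ℝ), 0 < b₀ → 2 < p₀ → ∀ (m : ℕ), 0 < m → ∃ γ₁ : ℝ, 0 < γ₁ ∧ γ₁ ≤ 1 ∧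
      ∀ (F : T3Family) (γ : ℝ), F.L = L → 0 < γ → γ ≤ γ₁ → ∃ (c₀ C₀ : ℝ) (A i₀ : ℕ), 0 < c₀ ∧
        ∀ (K j : ℕ), 1 ≤ j → j ≤ K → K ≤ m * (K - j + 1) → i₀ ≤ K - j →
          ∫ U, Real.exp (c₀ * B10.pFun b₀ p₀ (Real.sqrt (γ * ((F.L : ℝ)⁻¹) ^ (K - j))) ^ 2 *
              ∑ a : Plaq (F.P K) j, (if T3UnitScaleTilt.θBal F.L γ b₀ p₀ (K - j) ≤ GaugeGroup.dist1 (GaugeField.plaqHol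
                (Averaging.iter (fun i => BlockAveraging.blockAvg (P := F.P K) (j := i) T3UnitLawDensityEML.ℰp) j U) a)
                then (1 : ℝ) else 0)) ∂(T3UnitScaleTilt.gibbsK F T3UnitLawDensityEML.ℰp γ K) ≤
            Real.exp ((C₀ + A * Real.log ((γ * ((F.L : ℝ)⁻¹) ^ (K - j))⁻¹)) * (Fintype.card (Plaq (F.P K) j) : ℝ))) :
    Summit.QuantumFields.YangMills.Theses.UnitScaleTilt.HistoryTailL := by
  intro L b₁ p₁
  have hb₀ : 0 < max b₁ 1 := lt_of_lt_of_le one_pos (le_max_right _ _)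
  have hp₀ : 2 < max p₁ 3 := lt_of_lt_of_le (by norm_num) (le_max_right _ _)
  have hp₀1 : (1 : ℝ) ≤ max p₁ 3 := by linarith [le_max_right p₁ 3]
  refine ⟨max b₁ 1, max p₁ 3, le_max_left _ _, le_max_left _ _, hb₀, hp₀, fun m hm => ?_⟩
  obtain ⟨γ₁, hγ₁, hγ₁1, hW'⟩ := hW L (max b₁ 1) (max p₁ 3) hb₀ hp₀ m hm
  refine ⟨γ₁, hγ₁, fun F γ hFL hγ hγγ₁ => ?_⟩
  obtain ⟨c₀, C₀, A, i₀, hc₀, hN⟩ := hW' F γ hFL hγ hγγ₁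
  have hγ1 : γ ≤ 1 := hγγ₁.trans hγ₁1
  exact historyTailAt_of_perPlaquetteOnWedge F hγ hγ1 hb₀ hp₀1 hm
    (perPlaquetteOnWedge_of_countOnWedge F hγ hγ1 hc₀ hN)

/-- **LARGE-FIELD COUNT ON THE HISTORY WEDGE ⇒ `HistoryWedge.WedgeTailL`** (crux stmt-QuantumFields-27959 of route `HistoryWedge`, the organ's
FLOOR currency, BY NAME): same hypothesis LargeFieldCountW; §3 gives the Gaussian schema at every wedge pair, §2 turns it into the geometric rate
`D·ρ^{K−j}` with `ρ = 1/(2L³)`, `ρL³ = ½ < 1`.  Conditional certificate; both sides stay OPEN. [cite: Balaban1985UV3, (7) p.257 and (71) p.273] -/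
theorem wedgeTailL_of_largeFieldCountW
    (hW : ∀ (L : ℕ) (b₀ p₀ : ℝ), 0 < b₀ → 2 < p₀ → ∀ (m : ℕ), 0 < m → ∃ γ₁ : ℝ, 0 < γ₁ ∧ γ₁ ≤ 1 ∧
      ∀ (F : T3Family) (γ : ℝ), F.L = L → 0 < γ → γ ≤ γ₁ → ∃ (c₀ C₀ : ℝ) (A i₀ : ℕ), 0 < c₀ ∧
        ∀ (K j : ℕ), 1 ≤ j → j ≤ K → K ≤ m * (K - j + 1) → i₀ ≤ K - j →
          ∫ U, Real.exp (c₀ * B10.pFun b₀ p₀ (Real.sqrt (γ * ((F.L : ℝ)⁻¹) ^ (K - j))) ^ 2 *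
              ∑ a : Plaq (F.P K) j, (if T3UnitScaleTilt.θBal F.L γ b₀ p₀ (K - j) ≤ GaugeGroup.dist1 (GaugeField.plaqHol
                (Averaging.iter (fun i => BlockAveraging.blockAvg (P := F.P K) (j := i) T3UnitLawDensityEML.ℰp) j U) a)
                then (1 : ℝ) else 0)) ∂(T3UnitScaleTilt.gibbsK F T3UnitLawDensityEML.ℰp γ K) ≤
            Real.exp ((C₀ + A * Real.log ((γ * ((F.L : ℝ)⁻¹) ^ (K - j))⁻¹)) * (Fintype.card (Plaq (F.P K) j) : ℝ))) :
    Summit.QuantumFields.YangMills.Theses.HistoryWedge.WedgeTailL := by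
  intro L b₁ p₁
  have hb₀ : 0 < max b₁ 1 := lt_of_lt_of_le one_pos (le_max_right _ _)
  have hp₀ : 2 < max p₁ 3 := lt_of_lt_of_le (by norm_num) (le_max_right _ _)
  have hp₀1 : (1 : ℝ) ≤ max p₁ 3 := by linarith [le_max_right p₁ 3]
  refine ⟨max b₁ 1, max p₁ 3, le_max_left _ _, le_max_left _ _, hb₀, hp₀, fun m hm => ?_⟩
  obtain ⟨γ₁, hγ₁, hγ₁1, hW'⟩ := hW L (max b₁ 1) (max p₁ 3) hb₀ hp₀ m hm
  refine ⟨γ₁, hγ₁, hγ₁1, fun F γ hFL hγ hγγ₁ => ?_⟩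
  obtain ⟨c₀, C₀, A, i₀, hc₀, hN⟩ := hW' F γ hFL hγ hγγ₁
  have hγ1 : γ ≤ 1 := hγγ₁.trans hγ₁1
  -- §3: the schema at every wedge pair; §2: the schema is a floor rate
  obtain ⟨C, A', c, hC, hc, hschema⟩ := perPlaquetteOnWedge_of_countOnWedge F hγ hγ1 hc₀ hN
  obtain ⟨D, hD, hgeo⟩ := schema_le_geometric F hγ hγ1 hb₀ hp₀1 hC A' hc
  subst hFL
  have hL1 : (1 : ℝ) < F.L := by exact_mod_cast F.hL.2
  refine ⟨D, 1 / (2 * (F.L : ℝ) ^ 3), hD, by positivity, ?_, fun K j hj1 hjK hw p => ?_⟩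
  · -- `ρ L³ = ½ < 1`
    have hL3 : (0 : ℝ) < (F.L : ℝ) ^ 3 := by positivity
    rw [one_div, inv_mul_eq_div, div_lt_one (by positivity)]
    linarith
  · exact (hschema K j hj1 hjK hw p).trans (hgeo (K - j))

end Wedge

/-! ## §5 Corollaries: the kernel partial order `25301 ⇒ LogStiffness ⇒ LargeFieldCount ⇒ LargeFieldCountW ⇒ {19936's body, 27959}` -/

section Corollaries

/-- **LargeFieldCount ⇒ LargeFieldCountW** (drop the guards: `γ₁` independent of `m`, all pairs `j ≤ K`, `i₀ = 0`).
[cite: Balaban1985UV3, (71) p.273] -/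
theorem largeFieldCountW_of_largeFieldCount
    (hLFC : ∀ (L : ℕ) (b₀ p₀ : ℝ), 0 < b₀ → 2 < p₀ → ∃ γ₁ : ℝ, 0 < γ₁ ∧ γ₁ ≤ 1 ∧
      ∀ (F : T3Family) (γ : ℝ), F.L = L → 0 < γ → γ ≤ γ₁ → ∃ (c₀ C₀ : ℝ) (A : ℕ), 0 < c₀ ∧
        ∀ (K j : ℕ), j ≤ K →
          ∫ U, Real.exp (c₀ * B10.pFun b₀ p₀ (Real.sqrt (γ * ((F.L : ℝ)⁻¹) ^ (K - j))) ^ 2 *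
              ∑ a : Plaq (F.P K) j, (if T3UnitScaleTilt.θBal F.L γ b₀ p₀ (K - j) ≤ GaugeGroup.dist1 (GaugeField.plaqHol
                (Averaging.iter (fun i => BlockAveraging.blockAvg (P := F.P K) (j := i) T3UnitLawDensityEML.ℰp) j U) a)
                then (1 : ℝ) else 0)) ∂(T3UnitScaleTilt.gibbsK F T3UnitLawDensityEML.ℰp γ K) ≤
            Real.exp ((C₀ + A * Real.log ((γ * ((F.L : ℝ)⁻¹) ^ (K - j))⁻¹)) * (Fintype.card (Plaq (F.P K) j) : ℝ))) :
    ∀ (L : ℕ) (b₀ p₀ : ℝ), 0 < b₀ → 2 < p₀ → ∀ (m : ℕ), 0 < m → ∃ γ₁ : ℝ, 0 < γ₁ ∧ γ₁ ≤ 1 ∧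
      ∀ (F : T3Family) (γ : ℝ), F.L = L → 0 < γ → γ ≤ γ₁ → ∃ (c₀ C₀ : ℝ) (A i₀ : ℕ), 0 < c₀ ∧
        ∀ (K j : ℕ), 1 ≤ j → j ≤ K → K ≤ m * (K - j + 1) → i₀ ≤ K - j →
          ∫ U, Real.exp (c₀ * B10.pFun b₀ p₀ (Real.sqrt (γ * ((F.L : ℝ)⁻¹) ^ (K - j))) ^ 2 *
              ∑ a : Plaq (F.P K) j, (if T3UnitScaleTilt.θBal F.L γ b₀ p₀ (K - j) ≤ GaugeGroup.dist1 (GaugeField.plaqHol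
                (Averaging.iter (fun i => BlockAveraging.blockAvg (P := F.P K) (j := i) T3UnitLawDensityEML.ℰp) j U) a)
                then (1 : ℝ) else 0)) ∂(T3UnitScaleTilt.gibbsK F T3UnitLawDensityEML.ℰp γ K) ≤
            Real.exp ((C₀ + A * Real.log ((γ * ((F.L : ℝ)⁻¹) ^ (K - j))⁻¹)) * (Fintype.card (Plaq (F.P K) j) : ℝ)) := by
  intro L b₀ p₀ hb₀ hp₀ m _hm
  obtain ⟨γ₁, hγ₁, hγ₁1, hW'⟩ := hLFC L b₀ p₀ hb₀ hp₀
  refine ⟨γ₁, hγ₁, hγ₁1, fun F γ hFL hγ hγγ₁ => ?_⟩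
  obtain ⟨c₀, C₀, A, hc₀, hN⟩ := hW' F γ hFL hγ hγγ₁
  exact ⟨c₀, C₀, A, 0, hc₀, fun K j _ hjK _ _ => hN K j hjK⟩

/-- **THE CRUX ⇒ THE ORGAN'S FLOOR**: `CoarseStiffnessTail.CappedCoarseStiffnessL` (stmt-QuantumFields-25301) implies
`HistoryWedge.WedgeTailL` (stmt-QuantumFields-27959) — kernel partial order `25301 ⇒ LogStiffness ⇒ LargeFieldCount ⇒ LargeFieldCountW ⇒ 27959`.
The converse is NOT claimed.  Both sides stay OPEN. [cite: Balaban1985UV3, (71) p.273] -/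
theorem wedgeTailL_of_cappedCoarseStiffnessL
    (h : Summit.QuantumFields.YangMills.Theses.CoarseStiffnessTail.CappedCoarseStiffnessL) :
    Summit.QuantumFields.YangMills.Theses.HistoryWedge.WedgeTailL :=
  wedgeTailL_of_largeFieldCountW (largeFieldCountW_of_largeFieldCount (largeFieldCount_of_cappedCoarseStiffnessL h))

/-- **THE CRUX ⇒ `HistoryTailL` THROUGH THE WEDGE FORM** (the same conclusion as p636229's chain, now factored through LargeFieldCountW —
recorded so that the board shows one hypothesis serving both targets). [cite: Balaban1985UV3, (71) p.273] -/
theorem historyTailL_of_cappedCoarseStiffnessL_onWedge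
    (h : Summit.QuantumFields.YangMills.Theses.CoarseStiffnessTail.CappedCoarseStiffnessL) :
    Summit.QuantumFields.YangMills.Theses.UnitScaleTilt.HistoryTailL :=
  historyTailL_of_largeFieldCountW (largeFieldCountW_of_largeFieldCount (largeFieldCount_of_cappedCoarseStiffnessL h))

end Corollaries

end Summit.QuantumFields.YangMills.Theorems.CoarseStiffnessTailWedgeFloor

end
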